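import Literature.AlgebraicGeometry.AbelianSchemes.LevelStructureTorsionPointsBasis
import Literature.AlgebraicGeometry.AbelianSchemes.PoincarePullbackStabilizerOfLevelGeometric
import HarnessLib

/-!
# Over a connected base, the sections `σ^a` of a level-`n` structure EXHAUST the `n`-torsion sections: `{τ : τⁿ = 1} ⊆ range φ`
# ([MumfordFogartyKirwan1994] Ch. 7 §2 Def. 7.1; [GortzWedhorn2023] Prop. 27.188 (1))

Topic `Literature/AlgebraicGeometry/AbelianSchemes`; namespace `Literature.AlgebraicGeometry.AbelianSchemes.AbelianSchemeOver`.  THEOREMS ONLY (no definition, no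
named fact, no instance, no notation, no `sorry`).  Cell `hodgecm-mathlib` (D-0151), P6 «MOD» (crux hLiu418 = stmt-HodgeConjecture-24832, `--supports`,
count-neutral): line L3 (`stub_FROB`), ROOF road (ρ-𝔟), LA3-plan RULING #5 (C) → LA3-p03 (g2) — binder **(b2) `hK′φ : ↑(K₂.map λ_*) ⊆ Set.range φ.section_`**
of the ★ «DUAL-Q» engine head `nonempty_dualPair_quotient_idealTorsion_geometric` (LA6-p03 (g0) p849273, 2026-09-02T04:47Z report: «(b2) — over `κ̄`,
`range φ̂.section_ ⊇ Â[n](S)`»).  It is a corollary of ★ `LevelStructure.exists_eq_section_of_pow_eq_one` («over a CONNECTED base with `n` invertible an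
`n`-torsion section IS a basis combination `σ^a`»): every subgroup of `n`-torsion sections, in particular the image `f_*K₂` of a subgroup of `n`-torsion
sections under a homomorphism `f`, lies in `range φ.section_`; over `Spec Ω` (`Ω` any field with `(n : Ω) ≠ 0`) the base is connected with a point and `n`
is invertible in every residue field (★ `natCast_residueField_ne_zero_of_specMap`).  HC_CM is proved only modulo the printed citations until rung 0 closes;
this file is generic and changes no count.

* `LevelStructure.coe_subset_range_section_of_forall_pow_eq_one` — connected base `S` with a point, `n` invertible in the residue fields: a subgroup `K′ ≤ A(S)`
  of `n`-torsion sections lies in `range φ.section_`;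
* `LevelStructure.map_isMonHom_monoidHom_subset_range_section` — the same for `K′ := f_*K₂`, `K₂ ≤ B(S)` `n`-torsion, `f : B → A` a homomorphism;
* **`LevelStructure.map_isMonHom_monoidHom_subset_range_section_of_field`** — THE (b2) ROW over `S = Spec Ω`, `(n : Ω) ≠ 0` (binder shape of p849273 verbatim:
  `↑(K₂.map (IsMonHom.monoidHom lam (𝟙_ (Over (Spec (.of Ω)))))) ⊆ Set.range φ.section_`); `…coe_subset_range_section_of_field` (any `n`-torsion subgroup).

## References
* [MumfordFogartyKirwan1994] D. Mumford, J. Fogarty, F. Kirwan, *Geometric Invariant Theory*, 3rd ed. (1994), Ch. 7 §2 Definition 7.1 (p. 129).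
* [GortzWedhorn2023] U. Görtz, T. Wedhorn, *Algebraic Geometry II* (2023), Prop. 27.188 (1) (p. 675).
-/

set_option autoImplicit false

universe u

open CategoryTheory CategoryTheory.Limits AlgebraicGeometry MonoidalCategory

noncomputable section

namespace Literature.AlgebraicGeometry.AbelianSchemes

namespace AbelianSchemeOver

open scoped MonObj

namespace LevelStructure

variable {S : Scheme.{u}} {A : AbelianSchemeOver S} {g n : ℕ} (φ : LevelStructure g n A)

/-! ### §1 Connected base -/

/-- **A subgroup of `n`-torsion sections lies in `range φ.section_`** over a connected base with a point and `n` invertible in the residue fields (★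
`exists_eq_section_of_pow_eq_one` elementwise). [cite: MumfordFogartyKirwan1994, Ch. 7 §2 Definition 7.1 (p. 129)] [cite: GortzWedhorn2023, Prop. 27.188 (1) (p. 675)] -/
theorem coe_subset_range_section_of_forall_pow_eq_one [IsCommMonObj A.X] [PreconnectedSpace S]
    (hn : ∀ s : S, (n : S.residueField s) ≠ 0) (s₀ : S) (K' : Subgroup A.Sections) (hK' : ∀ τ : K', (τ : A.Sections) ^ n = 1) :
    (K' : Set A.Sections) ⊆ Set.range φ.section_ := fun τ hτ => by
  obtain ⟨a, ha⟩ := φ.exists_eq_section_of_pow_eq_one hn (hK' ⟨τ, hτ⟩) s₀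
  exact ⟨a, ha.symm⟩

/-- **The image `f_*K₂` of a subgroup of `n`-torsion sections under a homomorphism `f : B → A` lies in `range φ.section_`** (connected base with a point, `n`
invertible in the residue fields): `(σ ≫ f)^n = σ^n ≫ f = 1`. [cite: MumfordFogartyKirwan1994, Ch. 7 §2 Definition 7.1 (p. 129)] -/
theorem map_isMonHom_monoidHom_subset_range_section [IsCommMonObj A.X] [PreconnectedSpace S]
    (hn : ∀ s : S, (n : S.residueField s) ≠ 0) (s₀ : S) {B : AbelianSchemeOver S} (K₂ : Subgroup B.Sections)
    (hK₂ : ∀ σ : K₂, (σ : B.Sections) ^ n = 1) (f : B.X ⟶ A.X) [IsMonHom f] :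
    ((K₂.map (IsMonHom.monoidHom f (𝟙_ (Over S))) : Subgroup A.Sections) : Set A.Sections) ⊆ Set.range φ.section_ := by
  refine φ.coe_subset_range_section_of_forall_pow_eq_one hn s₀ _ fun τ => ?_
  obtain ⟨σ, hσ, hστ⟩ := Subgroup.mem_map.mp τ.2
  rw [← hστ, ← map_pow, hK₂ ⟨σ, hσ⟩, map_one]

end LevelStructure

/-! ### §2 Over `Spec Ω`, `(n : Ω) ≠ 0` -/

section Field

variable {Ω : Type u} [Field Ω] {A : AbelianSchemeOver (Spec (.of Ω))} {g n : ℕ} (φ : LevelStructure g n A)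

/-- `Spec` of a field is preconnected (it is irreducible). [cite: GortzWedhorn2023, Prop. 27.188 (1) (p. 675)] -/
theorem preconnectedSpace_spec_field : PreconnectedSpace ↥(Spec (.of Ω)) := by
  haveI : IrreducibleSpace ↥(Spec (.of Ω)) := inferInstanceAs (IrreducibleSpace (PrimeSpectrum Ω))
  infer_instance

/-- **(b2) for any `n`-torsion subgroup over `Spec Ω`**: `(n : Ω) ≠ 0` ⇒ `↑K′ ⊆ Set.range φ.section_`. [cite: MumfordFogartyKirwan1994, Ch. 7 §2 Definition 7.1 (p. 129)] -/
theorem LevelStructure.coe_subset_range_section_of_field [IsCommMonObj A.X] (hn0 : (n : Ω) ≠ 0) (K' : Subgroup A.Sections)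
    (hK' : ∀ τ : K', (τ : A.Sections) ^ n = 1) : (K' : Set A.Sections) ⊆ Set.range φ.section_ := by
  haveI := preconnectedSpace_spec_field (Ω := Ω)
  exact φ.coe_subset_range_section_of_forall_pow_eq_one (fun s => natCast_residueField_ne_zero_of_specMap (𝟙 (Spec (.of Ω))) s hn0)
    (IsLocalRing.closedPoint Ω) K' hK'

/-- **THE (b2) ROW `hK′φ` of the «DUAL-Q» engine head** (binder shape of ★ `nonempty_dualPair_quotient_idealTorsion_geometric` verbatim): for `lam : B → A` a
homomorphism of abelian schemes over `Spec Ω`, `K₂ ≤ B(S)` with `σⁿ = 1`, `(n : Ω) ≠ 0` and any level-`n` structure `φ` on `A`: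
`↑(K₂.map (IsMonHom.monoidHom lam (𝟙_ (Over (Spec Ω))))) ⊆ Set.range φ.section_`.  (Use: `A := D.hat`, `B := A`, `lam := λ`, `φ := φ̂` from ★ H6
`nonempty_levelStructure_of_isAlgClosed`.) [cite: MumfordFogartyKirwan1994, Ch. 7 §2 Definition 7.1 (p. 129)] [cite: GortzWedhorn2023, Prop. 27.188 (1) (p. 675)] -/
theorem LevelStructure.map_isMonHom_monoidHom_subset_range_section_of_field [IsCommMonObj A.X] (hn0 : (n : Ω) ≠ 0)
    {B : AbelianSchemeOver (Spec (.of Ω))} (K₂ : Subgroup B.Sections) (hK₂ : ∀ σ : K₂, (σ : B.Sections) ^ n = 1)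
    (lam : B.X ⟶ A.X) [IsMonHom lam] :
    ((K₂.map (IsMonHom.monoidHom lam (𝟙_ (Over (Spec (.of Ω))))) : Subgroup A.Sections) : Set A.Sections) ⊆ Set.range φ.section_ := by
  haveI := preconnectedSpace_spec_field (Ω := Ω)
  exact φ.map_isMonHom_monoidHom_subset_range_section (fun s => natCast_residueField_ne_zero_of_specMap (𝟙 (Spec (.of Ω))) s hn0)
    (IsLocalRing.closedPoint Ω) K₂ hK₂ lam

end Field

end AbelianSchemeOver

end Literature.AlgebraicGeometry.AbelianSchemes

end
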